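import Literature.Analysis.FluidPDE.TransverseProfile
import Literature.Analysis.FunctionSpaces.TorusPeriodizationCube
import Literature.Analysis.FunctionSpaces.TorusCalculus
import HarnessLib

/-!
# Periodic transverse Mikado profiles on `𝕋^m`: periodisation of the concentrated profiles,
derivatives, weighted Laplacian, unit energy, `L^p` scaling

Second file of the Mikado-flow construction for the convex-integration step of
A. Cheskidov, X. Luo, *Sharp nonuniqueness for the Navier–Stokes equations*, Invent. Math. 229
(2022) = arXiv:2009.06596, §4.1 (4.5)–(4.7), Thm. 4.3. The Euclidean profiles
`Θ_μ, φ_μ, ψ_μ ∈ C_c^∞(B̄(c₀, 1/(4μ)))` of `Literature.Analysis.FluidPDE.TransverseProfile` are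
supported, for `μ ≥ 1`, inside the open unit cube, so their lattice periodisations
(`Torus.periodize`, `TorusPeriodization`) have exactly one non-zero term at every point
(`Torus.periodize_eq_apply_repr`, `TorusPeriodizationCube`): everything about them is read off the
Euclidean profile at `repr x`.

* `Transverse.conc κ₀ a μ f₀ = periodize (κ₀ · rescale a μ f₀)` for a profile `f₀`
  (`Transverse.IsProfile`: smooth, `tsupport ⊆ B̄(c₀, 1/4)`), `μ ≥ 1`: values (`conc_apply`),
  smoothness (`isSmooth_conc`), **derivatives** `∂ₗ conc κ₀ a μ f₀ = conc κ₀ (a+1) μ (∂ₗf₀)`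
  (`partialDeriv_conc`, from `Torus.fderiv_periodize`), **weighted Laplacian**
  `∑ cₗ∂ₗ² conc κ₀ a μ f₀ = conc κ₀ (a+2) μ (𝓛_c f₀)` (`torusWLap_conc`), the sup bound
  `|κ₀| μ^a sup|f₀|`, and **unfolded integrals** `∫_{𝕋^m} G(conc) = ∫_{ℝ^m} G(κ₀ rescale a μ f₀)`
  for continuous `G` with `G 0 = 0` (`integral_comp_conc`, from `Torus.integral_eq_integral_perSum_repr`),
  whence `∫ conc`, `∫ conc²`, `∫ |conc|^p = |κ₀|^p μ^{ap-m} ∫|f₀|^p`;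
* the periodic profiles `Transverse.thetaT c μ`, `phiT c μ`, `psiT c μ` (periodisations of
  `Θ_μ, φ_μ, ψ_μ`): smooth, `∑ cₗ∂ₗ² thetaT = phiT`, `∑ cₗ∂ₗ² phiT = psiT` (`torusWLap_thetaT`,
  `torusWLap_phiT` — CL22 (4.7) `Δφ_k = ψ_k` in transverse variables), **unit energy**
  `∫_{𝕋^m} psiT² = 1` (`integral_psiT_sq`, CL22 (4.7)), zero means of `psiT`, `phiT`.

Pulled back to `𝕋^d` along the integer transverse forms of a lattice direction (sibling file),
these give the stationary Mikado flows `W_k = ψ_k e_k` with `div Ω_k = W_k` of CL22 Thm. 4.3 and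
the scalings `μ^{m + (d-1)/2 - (d-1)/p}` of Thm. 4.3 (2). Everything is proved; no named facts.
Part of the decomposition of `Torus.CheskidovLuo2022ConvexIntegration` (CL22 Prop. 4.1).

## References

* A. Cheskidov, X. Luo, Invent. Math. 229 (2022) = arXiv:2009.06596, §4.1 (4.5)–(4.7), Thm. 4.3.
  [`CheskidovLuo2022`]
-/

noncomputable section

open Set Filter Topology Function MeasureTheory Metric Module
open scoped ContDiff

namespace Literature.Analysis.FluidPDE

namespace Transverse

open FunctionSpaces FunctionSpaces.Torus

variable {m : Type*} [Fintype m] [DecidableEq m]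
variable {f₀ g₀ : EuclideanSpace ℝ m → ℝ} {κ₀ a μ : ℝ}

/-! ## Functions supported near the cube centre are cube-supported -/

omit [DecidableEq m] in
/-- A point of `B̄(c₀, r)`, `r < 1/2`, has all coordinates in `(0, 1)`. [folklore] -/
theorem mem_openCube_of_mem_closedBall {r : ℝ} (hr : r < 1 / 2) {z : EuclideanSpace ℝ m}
    (hz : z ∈ closedBall (centre m) r) : ∀ i, z i ∈ Ioo (0 : ℝ) 1 := by
  intro i
  have h1 : |z i - 1 / 2| ≤ r := by
    have h := PiLp.norm_apply_le (z - centre m) i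
    rw [mem_closedBall, dist_eq_norm] at hz
    simp only [PiLp.sub_apply, centre, Real.norm_eq_abs] at h
    exact h.trans hz
  constructor <;> [linarith [(abs_le.mp h1).1]; linarith [(abs_le.mp h1).2]]

omit [DecidableEq m] in
/-- A function with `tsupport ⊆ B̄(c₀, r)`, `r < 1/2`, vanishes off the open unit cube. [folklore] -/
theorem eq_zero_off_cube {F : Type*} [Zero F] {g : EuclideanSpace ℝ m → F} {r : ℝ} (hr : r < 1 / 2)
    (hg : tsupport g ⊆ closedBall (centre m) r) (y : EuclideanSpace ℝ m) (hy : ¬ ∀ i, y i ∈ Ioo (0 : ℝ) 1) :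
    g y = 0 :=
  image_eq_zero_of_notMem_tsupport fun h => hy (mem_openCube_of_mem_closedBall hr (hg h))

omit [DecidableEq m] in
/-- `tsupport ⊆ B̄(c₀, r)` gives `tsupport ⊆ B̄(0, ‖c₀‖ + r)`. [folklore] -/
theorem tsupport_subset_closedBall_zero {F : Type*} [Zero F] [TopologicalSpace F] {g : EuclideanSpace ℝ m → F} {r : ℝ}
    (hg : tsupport g ⊆ closedBall (centre m) r) : tsupport g ⊆ closedBall 0 (‖centre m‖ + r) :=
  hg.trans (closedBall_subset_closedBall' (by rw [dist_zero_right]; linarith))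

/-! ## Concentrated periodic profiles on `𝕋^m` -/

/-- **Concentrated periodic profile**: the torus periodisation of `κ₀ · rescale a μ f₀`. [folklore] -/
def conc (κ₀ a μ : ℝ) (f₀ : EuclideanSpace ℝ m → ℝ) : UnitAddTorus m → ℝ :=
  periodize fun z => κ₀ * rescale a μ f₀ z

/-- The hypotheses on a transverse profile: smooth with `tsupport ⊆ B̄(c₀, 1/4)`. [folklore] -/
structure IsProfile (f₀ : EuclideanSpace ℝ m → ℝ) : Prop where
  smooth : ContDiff ℝ ∞ f₀
  tsupport_subset : tsupport f₀ ⊆ closedBall (centre m) (1 / 4)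

namespace IsProfile

omit [DecidableEq m] in
/-- Profiles have compact support. [folklore] -/
theorem hasCompactSupport (h : IsProfile f₀) : HasCompactSupport f₀ :=
  HasCompactSupport.of_support_subset_isCompact (isCompact_closedBall _ _) ((subset_tsupport _).trans h.tsupport_subset)

/-- Partial derivatives of profiles are profiles. [folklore] -/
theorem pd (h : IsProfile f₀) (l : m) : IsProfile (pd l f₀) :=
  ⟨contDiff_pd h.smooth l, (tsupport_pd_subset f₀ l).trans h.tsupport_subset⟩

/-- Weighted Laplacians of profiles are profiles. [folklore] -/
theorem wLap (h : IsProfile f₀) (c : m → ℝ) : IsProfile (wLap c f₀) :=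
  ⟨contDiff_wLap h.smooth c, (tsupport_wLap_subset c f₀).trans h.tsupport_subset⟩

omit [DecidableEq m] in
/-- Profiles are bounded. [folklore] -/
theorem exists_bound (h : IsProfile f₀) : ∃ B, 0 ≤ B ∧ ∀ z, |f₀ z| ≤ B := by
  obtain ⟨B, hB⟩ := h.hasCompactSupport.exists_bound_of_continuous h.smooth.continuous
  exact ⟨max B 0, le_max_right _ _, fun z => (Real.norm_eq_abs _ ▸ hB z).trans (le_max_left _ _)⟩

end IsProfile

omit [DecidableEq m] in
/-- `Θ₀` is a profile. [folklore] -/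
theorem isProfile_theta0 : IsProfile (theta0 m) := ⟨contDiff_theta0, tsupport_theta0.le⟩
/-- `φ₀` is a profile. [folklore] -/
theorem isProfile_phi0 (c : m → ℝ) : IsProfile (phi0 c) := ⟨contDiff_phi0 c, tsupport_phi0_subset c⟩
/-- `ψ₀` is a profile. [folklore] -/
theorem isProfile_psi0 (c : m → ℝ) : IsProfile (psi0 c) := ⟨contDiff_psi0 c, tsupport_psi0_subset c⟩

section Conc

omit [DecidableEq m] in
/-- The integrand of `conc` has `tsupport ⊆ B̄(c₀, 1/(4μ)) ⊆ B̄(c₀, 1/4)` for `μ ≥ 1`. [folklore] -/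
theorem tsupport_integrand_subset (hf : IsProfile f₀) (hμ : 1 ≤ μ) (κ₀ a : ℝ) :
    tsupport (fun z => κ₀ * rescale a μ f₀ z) ⊆ closedBall (centre m) (1 / 4) := by
  have hμ0 : 0 < μ := by linarith
  refine (tsupport_const_mul_subset κ₀ _).trans ((tsupport_rescale_subset hμ0 hf.tsupport_subset a).trans ?_)
  exact closedBall_subset_closedBall (div_le_self (by norm_num) hμ)

omit [DecidableEq m] in
/-- The integrand of `conc` is smooth. [folklore] -/
theorem contDiff_integrand (hf : IsProfile f₀) (κ₀ a μ : ℝ) : ContDiff ℝ ∞ fun z => κ₀ * rescale a μ f₀ z :=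
  contDiff_const.mul (contDiff_rescale hf.smooth a μ)

omit [DecidableEq m] in
/-- The integrand of `conc` vanishes off the open unit cube (`μ ≥ 1`). [folklore] -/
theorem integrand_eq_zero_off_cube (hf : IsProfile f₀) (hμ : 1 ≤ μ) (κ₀ a : ℝ) (y : EuclideanSpace ℝ m)
    (hy : ¬ ∀ i, y i ∈ Ioo (0 : ℝ) 1) : κ₀ * rescale a μ f₀ y = 0 :=
  eq_zero_off_cube (by norm_num) (tsupport_integrand_subset hf hμ κ₀ a) y hy

/-- **Values**: `conc κ₀ a μ f₀ (x) = κ₀ μ^a f₀(A_μ (repr x))` (a single lattice term). [folklore] -/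
theorem conc_apply (hf : IsProfile f₀) (hμ : 1 ≤ μ) (κ₀ a : ℝ) (x : UnitAddTorus m) :
    conc κ₀ a μ f₀ x = κ₀ * rescale a μ f₀ (repr x) :=
  periodize_eq_apply_repr (integrand_eq_zero_off_cube hf hμ κ₀ a) x

/-- The concentrated periodic profile is smooth on `𝕋^m` (`μ ≥ 1`). [folklore] -/
theorem isSmooth_conc (hf : IsProfile f₀) (hμ : 1 ≤ μ) (κ₀ a : ℝ) : IsSmooth (conc κ₀ a μ f₀) :=
  isSmooth_periodize (contDiff_integrand hf κ₀ a μ) (tsupport_subset_closedBall_zero (tsupport_integrand_subset hf hμ κ₀ a))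

/-- **Derivatives**: `∂ₗ (conc κ₀ a μ f₀) = conc κ₀ (a+1) μ (∂ₗ f₀)` (`μ ≥ 1`). [folklore] -/
theorem partialDeriv_conc (hf : IsProfile f₀) (hμ : 1 ≤ μ) (κ₀ a : ℝ) (l : m) :
    FunctionSpaces.Torus.partialDeriv l (conc κ₀ a μ f₀) = conc κ₀ (a + 1) μ (pd l f₀) := by
  have hμ0 : 0 < μ := by linarith
  funext x
  have hsm : IsSmooth (conc κ₀ a μ f₀) := isSmooth_conc hf hμ κ₀ a
  rw [partialDeriv_eq_fderiv_apply (hsm.isContDiff (by simp)) l x]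
  conv_lhs => rw [← proj_repr x]
  rw [conc, fderiv_periodize ((contDiff_integrand hf κ₀ a μ).of_le (by simp))
    (tsupport_subset_closedBall_zero (tsupport_integrand_subset hf hμ κ₀ a))]
  -- the lattice sum of derivatives has a single term
  have hcube : ∀ y, (¬ ∀ i, y i ∈ Ioo (0 : ℝ) 1) → fderiv ℝ (fun z => κ₀ * rescale a μ f₀ z) y = 0 := fun y hy =>
    image_eq_zero_of_notMem_tsupport fun h => hy (mem_openCube_of_mem_closedBall (by norm_num)
      (((tsupport_fderiv_subset ℝ).trans (tsupport_integrand_subset hf hμ κ₀ a)) h))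
  rw [perSum_eq_apply_repr_proj hcube, proj_repr, conc_apply (hf.pd l) hμ]
  -- compute the derivative of the integrand
  have hd : DifferentiableAt ℝ (rescale a μ f₀) (repr x) :=
    ((contDiff_rescale hf.smooth a μ).differentiable (by simp)) _
  rw [fderiv_const_mul hd, _root_.smul_apply, smul_eq_mul, ← pd_apply, pd_rescale hμ0 hf.smooth]

end Conc


/-! ## Second derivatives: the weighted Laplacian on the torus -/

/-- The weighted sum of pure second partial derivatives `∑ₗ cₗ ∂ₗ∂ₗ P` of a torus function
(the torus Laplacian of a pulled-back transverse profile is of this form). [folklore] -/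
def torusWLap (c : m → ℝ) (P : UnitAddTorus m → ℝ) (x : UnitAddTorus m) : ℝ :=
  ∑ l, c l * FunctionSpaces.Torus.partialDeriv l (FunctionSpaces.Torus.partialDeriv l P) x

/-- **`∑ cₗ ∂ₗ² (conc κ₀ a μ f₀) = conc κ₀ (a+2) μ (𝓛_c f₀)`** (`μ ≥ 1`). [folklore] -/
theorem torusWLap_conc (hf : IsProfile f₀) (hμ : 1 ≤ μ) (κ₀ a : ℝ) (c : m → ℝ) :
    torusWLap c (conc κ₀ a μ f₀) = conc κ₀ (a + 2) μ (wLap c f₀) := by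
  have hμ0 : 0 < μ := by linarith
  funext x
  simp only [torusWLap, partialDeriv_conc hf hμ, partialDeriv_conc (hf.pd _) hμ]
  rw [conc_apply (hf.wLap c) hμ]
  simp only [conc_apply ((hf.pd _).pd _) hμ, rescale_apply, wLap_apply, Finset.mul_sum,
    show a + 1 + 1 = a + 2 by ring]
  exact Finset.sum_congr rfl fun l _ => by ring

/-! ## Pointwise and integral bounds -/

/-- Sup bound `|conc κ₀ a μ f₀| ≤ |κ₀| μ^a sup|f₀|` (`μ ≥ 1`). [folklore] -/
theorem abs_conc_le (hf : IsProfile f₀) (hμ : 1 ≤ μ) {B : ℝ} (hB : ∀ z, |f₀ z| ≤ B) (κ₀ a : ℝ) (x : UnitAddTorus m) :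
    |conc κ₀ a μ f₀ x| ≤ |κ₀| * μ ^ a * B := by
  have hμ0 : 0 < μ := by linarith
  rw [conc_apply hf hμ, abs_mul, mul_assoc]
  exact mul_le_mul_of_nonneg_left (abs_rescale_le hμ0 hB a _) (abs_nonneg _)

/-- **Unfolding integrals of periodic profiles**: for continuous `G` with `G 0 = 0`,
`∫_{𝕋^m} G(conc κ₀ a μ f₀) = ∫_{ℝ^m} G(κ₀ · rescale a μ f₀)` (`μ ≥ 1`; one lattice term per point).
[folklore] -/
theorem integral_comp_conc (hf : IsProfile f₀) (hμ : 1 ≤ μ) (κ₀ a : ℝ) {G : ℝ → ℝ} (hG : Continuous G) (hG0 : G 0 = 0) :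
    ∫ x, G (conc κ₀ a μ f₀ x) = ∫ z, G (κ₀ * rescale a μ f₀ z) := by
  have hμ0 : 0 < μ := by linarith
  set g : EuclideanSpace ℝ m → ℝ := fun z => κ₀ * rescale a μ f₀ z with hg
  have hcube : ∀ y, (¬ ∀ i, y i ∈ Ioo (0 : ℝ) 1) → G (g y) = 0 := fun y hy => by
    rw [hg]; dsimp only; rw [integrand_eq_zero_off_cube hf hμ κ₀ a y hy, hG0]
  have hGc : HasCompactSupport fun z => G (g z) := by
    refine HasCompactSupport.of_support_subset_isCompact (isCompact_closedBall (centre m) (1 / 4)) ?_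
    intro z hz
    by_contra hz'
    exact hz (by
      have : g z = 0 := image_eq_zero_of_notMem_tsupport fun h => hz' (tsupport_integrand_subset hf hμ κ₀ a h)
      simp only [this, hG0])
  have hGi : Integrable fun z => G (g z) :=
    (hG.comp (contDiff_integrand hf κ₀ a μ).continuous).integrable_of_hasCompactSupport hGc
  have hsupp : support (fun z => G (g z)) ⊆ closedBall 0 (Fintype.card m) :=
    support_subset_closedBall_of_cube hcube
  rw [integral_eq_integral_perSum_repr hGi hsupp]
  refine integral_congr_ae (Eventually.of_forall fun x => ?_)
  dsimp only
  rw [conc_apply hf hμ, perSum_eq_self_of_mem_unitCube hcube (repr_mem_unitCube x)]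

/-- `∫ conc = κ₀ μ^{a-m} ∫ f₀` (`μ ≥ 1`). [folklore] -/
theorem integral_conc (hf : IsProfile f₀) (hμ : 1 ≤ μ) (κ₀ a : ℝ) :
    ∫ x, conc κ₀ a μ f₀ x = κ₀ * μ ^ (a - Fintype.card m) * ∫ z, f₀ z := by
  have hμ0 : 0 < μ := by linarith
  have h := integral_comp_conc hf hμ κ₀ a continuous_id rfl
  simp only [id] at h
  rw [h, integral_const_mul, integral_rescale hμ0, mul_assoc]

/-- `∫ conc² = κ₀² μ^{2a-m} ∫ f₀²` (`μ ≥ 1`). [folklore] -/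
theorem integral_conc_sq (hf : IsProfile f₀) (hμ : 1 ≤ μ) (κ₀ a : ℝ) :
    ∫ x, conc κ₀ a μ f₀ x ^ 2 = κ₀ ^ 2 * μ ^ (2 * a - Fintype.card m) * ∫ z, f₀ z * f₀ z := by
  have hμ0 : 0 < μ := by linarith
  have h := integral_comp_conc hf hμ κ₀ a (continuous_pow 2) (by norm_num)
  rw [h]
  have h1 : ∀ z, (κ₀ * rescale a μ f₀ z) ^ 2 = κ₀ ^ 2 * (rescale a μ f₀ z * rescale a μ f₀ z) := fun z => by ring
  simp_rw [h1]
  rw [integral_const_mul, integral_rescale_mul_rescale hμ0, mul_assoc]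

/-- `∫ |conc|^p = |κ₀|^p μ^{ap-m} ∫ |f₀|^p` (`μ ≥ 1`, `p > 0`): the `L^p` scaling of the periodic
concentrated profiles. [cite: CheskidovLuo2022, Thm. 4.3 (2)] -/
theorem integral_abs_conc_rpow (hf : IsProfile f₀) (hμ : 1 ≤ μ) (κ₀ a : ℝ) {p : ℝ} (hp : 0 < p) :
    ∫ x, |conc κ₀ a μ f₀ x| ^ p = |κ₀| ^ p * μ ^ (a * p - Fintype.card m) * ∫ z, |f₀ z| ^ p := by
  have hμ0 : 0 < μ := by linarith
  have h := integral_comp_conc hf hμ κ₀ a (continuous_abs.rpow_const fun _ => Or.inr hp.le)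
    (by simp [Real.zero_rpow hp.ne'])
  rw [h]
  have h1 : ∀ z, |κ₀ * rescale a μ f₀ z| ^ p = |κ₀| ^ p * |rescale a μ f₀ z| ^ p := fun z => by
    rw [abs_mul, Real.mul_rpow (abs_nonneg _) (abs_nonneg _)]
  simp_rw [h1]
  rw [integral_const_mul, integral_abs_rescale_rpow hμ0, mul_assoc]

/-! ## The periodic transverse Mikado profiles `Θ`, `Φ`, `Ψ` on `𝕋^m` -/

/-- `Θ = periodize Θ_μ` (second-generation potential). [folklore] -/
def thetaT (c : m → ℝ) (μ : ℝ) : UnitAddTorus m → ℝ :=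
  conc (normConst c) ((Fintype.card m : ℝ) / 2 - 4) μ (theta0 m)

/-- `Φ = periodize φ_μ` (first-generation potential; CL22 (4.6)). [cite: CheskidovLuo2022, §4.1 (4.6)] -/
def phiT (c : m → ℝ) (μ : ℝ) : UnitAddTorus m → ℝ :=
  conc (normConst c) ((Fintype.card m : ℝ) / 2 - 2) μ (phi0 c)

/-- `Ψ = periodize ψ_μ` (the transverse pipe profile on `𝕋^m`; CL22 (4.5)). [cite: CheskidovLuo2022, §4.1 (4.5)] -/
def psiT (c : m → ℝ) (μ : ℝ) : UnitAddTorus m → ℝ :=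
  conc (normConst c) ((Fintype.card m : ℝ) / 2) μ (psi0 c)

variable {c : m → ℝ}

/-- `Θ` is smooth on `𝕋^m` (`μ ≥ 1`). [folklore] -/
theorem isSmooth_thetaT (c : m → ℝ) (hμ : 1 ≤ μ) : IsSmooth (thetaT c μ) := isSmooth_conc isProfile_theta0 hμ _ _
/-- `Φ` is smooth on `𝕋^m` (`μ ≥ 1`). [folklore] -/
theorem isSmooth_phiT (c : m → ℝ) (hμ : 1 ≤ μ) : IsSmooth (phiT c μ) := isSmooth_conc (isProfile_phi0 c) hμ _ _
/-- `Ψ` is smooth on `𝕋^m` (`μ ≥ 1`). [folklore] -/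
theorem isSmooth_psiT (c : m → ℝ) (hμ : 1 ≤ μ) : IsSmooth (psiT c μ) := isSmooth_conc (isProfile_psi0 c) hμ _ _

/-- **`∑ cₗ ∂ₗ² Θ = Φ`** on `𝕋^m` (`μ ≥ 1`). [folklore] -/
theorem torusWLap_thetaT (c : m → ℝ) (hμ : 1 ≤ μ) : torusWLap c (thetaT c μ) = phiT c μ := by
  rw [thetaT, torusWLap_conc isProfile_theta0 hμ, phiT, show (Fintype.card m : ℝ) / 2 - 4 + 2 = Fintype.card m / 2 - 2 by ring]
  rfl

/-- **`∑ cₗ ∂ₗ² Φ = Ψ`** on `𝕋^m` (`μ ≥ 1`; CL22 (4.7) `Δφ_k = ψ_k`, transverse form). [cite: CheskidovLuo2022, §4.1 (4.7)] -/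
theorem torusWLap_phiT (c : m → ℝ) (hμ : 1 ≤ μ) : torusWLap c (phiT c μ) = psiT c μ := by
  rw [phiT, torusWLap_conc (isProfile_phi0 c) hμ, psiT, show (Fintype.card m : ℝ) / 2 - 2 + 2 = Fintype.card m / 2 by ring]
  rfl

/-- **Unit energy on the torus**: `∫_{𝕋^m} Ψ² = 1` (`μ ≥ 1`; CL22 (4.7)). [cite: CheskidovLuo2022, §4.1 (4.7)] -/
theorem integral_psiT_sq [Nonempty m] (hc : ∀ l, 0 < c l) (hμ : 1 ≤ μ) : ∫ x, psiT c μ x ^ 2 = 1 := by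
  rw [psiT, integral_conc_sq (isProfile_psi0 c) hμ, show 2 * ((Fintype.card m : ℝ) / 2) - Fintype.card m = 0 by ring,
    Real.rpow_zero, mul_one]
  exact normConst_sq_mul_energy0 hc

/-- `∫_{𝕋^m} Ψ = 0` (`μ ≥ 1`). [folklore] -/
theorem integral_psiT (c : m → ℝ) (hμ : 1 ≤ μ) : ∫ x, psiT c μ x = 0 := by
  have hμ0 : 0 < μ := by linarith
  rw [psiT, integral_conc (isProfile_psi0 c) hμ]
  have : ∫ z, psi0 c z = 0 := integral_wLap_eq_zero (contDiff_phi0 c) (hasCompactSupport_phi0 c) c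
  rw [this, mul_zero]

/-- `∫_{𝕋^m} Φ = 0` (`μ ≥ 1`). [folklore] -/
theorem integral_phiT (c : m → ℝ) (hμ : 1 ≤ μ) : ∫ x, phiT c μ x = 0 := by
  have hμ0 : 0 < μ := by linarith
  rw [phiT, integral_conc (isProfile_phi0 c) hμ]
  have : ∫ z, phi0 c z = 0 := integral_wLap_eq_zero contDiff_theta0 hasCompactSupport_theta0 c
  rw [this, mul_zero]

end Transverse

end Literature.Analysis.FluidPDE
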